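import Mathlib
import Literature.NumberTheory.Sieve.LiouvillePolynomialValuesP54MinorArc
import Literature.NumberTheory.Sieve.LiouvillePolynomialValuesP54MajorArc
import HarnessLib

/-!
# Teräväinen 2024, Proposition 5.4 for `λ`: the reduction for one starting point

Support file (everything PROVED; no definitions, no named facts) towards the named fact
`Literature.NumberTheory.Sieve.teravainen2024_cor_2_1` (J. Teräväinen, *On the Liouville function
at polynomial arguments*, Amer. J. Math. 146 (2024) = arXiv:2010.07924, Corollary 2.1 ⊂
Theorem 2.6 for `g_j = λ`, proved in §5). For ONE starting point `y` this file carries out the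
deterministic part of the proof of Proposition 5.4 (§5.4) for a `±1`-valued sequence along a
progression `n ≡ a (mod r)` in `(y, y + H']`:

* re-parametrisation `n = n₀ + r t`, `0 < t ≤ N'` (`Teravainen2024.sum_filter_modEq_Ioc_eq_sum_Ioc`,
  `card_filter_modEq_Ioc_eq`);
* the Weyl-sum dichotomy for the re-parametrised phase `Q(t) = -P(n₀ + r t)` (file XIII,
  `weyl_sums_small_of_minorArc`): either all Weyl sums `∑_{t≤N'} e(jQ(t))`, `j ≤ M`, are `< ε_w N'`
  — and then Case 2 (file XV, `minorArc_correlation_le`) bounds the correlation by `(1-2δ)N'` —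
  or `Q` is major arc with a denominator `q ≤ M K₁`, and then Case 1 (file XVI,
  `majorArc_norm_sum_le`) bounds the correlation by class sums of the sequence along residue
  classes `t ≡ c (mod q)` on `M₁` pieces;
* consequently (`Teravainen2024.exists_large_classSum_of_large_correlation`): if the correlation
  exceeds `(1-δ)N'` then some class sum on some piece is `≥ N'/(2 M₁ q)`;
* tools for the counting step of Proposition 5.4 (next file): Markov's inequality on a finite set
  (`card_filter_mul_le_sum`), shifting sums (`sum_range_shift_le`), the transfer of a class sum
  on a piece to a sum of the original sequence along a progression modulo `r q` in a short
  interval (`sum_classSum_eq_sum_progression`, the shape of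
  `LiouvillePolynomialValuesProgressionMR.lean`), the growth fact `c (log log H)^B ≤ log H`
  for large `H` (`exists_loglog_pow_le_log`), and ABSOLUTE admissible Case-2 parameters
  `J = 200`, `M = 199999`, `ε_w = 10⁻¹⁰`, `δ = 1/30` (`endgame_params`).

## References
* J. Teräväinen, Amer. J. Math. 146 (2024), §5.4, proof of Proposition 5.4 (pp. 14–15).
  [Teravainen2024]
* B. Green, T. Tao, Ann. of Math. 175 (2012), Prop. 4.3 (the Weyl-sum dichotomy).
  [GreenTao2012Nilmanifolds]
-/

noncomputable section

open Finset Complex Polynomial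

namespace Literature.NumberTheory.Sieve

namespace Teravainen2024

open Literature.NumberTheory.LFunctions Literature.NumberTheory.Sieve.Vinogradov

/-! ### Integer-indexed versus natural-indexed sums -/

/-- `∑_{n ∈ (0, N] ⊂ ℤ} f(n) = ∑_{t ∈ (0, N] ⊂ ℕ} f(t)`. [folklore] -/
theorem sum_Ioc_int_eq_sum_Ioc_nat {α : Type*} [AddCommMonoid α] (f : ℤ → α) (N : ℕ) :
    ∑ n ∈ Finset.Ioc (0 : ℤ) N, f n = ∑ t ∈ Finset.Ioc 0 N, f (t : ℤ) := by
  refine Finset.sum_nbij' (fun n => n.toNat) (fun t => (t : ℤ)) ?_ ?_ ?_ ?_ ?_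
  · intro n hn
    rw [Finset.mem_Ioc] at hn ⊢
    omega
  · intro t ht
    rw [Finset.mem_Ioc] at ht ⊢
    omega
  · intro n hn
    rw [Finset.mem_Ioc] at hn
    show ((n.toNat : ℕ) : ℤ) = n
    omega
  · intro t _
    simp
  · intro n hn
    rw [Finset.mem_Ioc] at hn
    show f n = f ((n.toNat : ℕ) : ℤ)
    rw [Int.toNat_of_nonneg (by omega)]

/-! ### Re-parametrising a progression in a short interval -/

/-- **Re-parametrisation.** For `1 ≤ r ≤ y` and the base point `n₀ = y - ((y - a mod r) mod r)`
(the largest `n₀ ≤ y` with `n₀ ≡ a (mod r)`), the members of the progression `n ≡ a (mod r)` in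
`(y, y + H]` are exactly `n₀ + r t`, `0 < t ≤ N'` with `N' = ⌊(y + H - n₀)/r⌋`:
`∑_{y<n≤y+H, n≡a (r)} F(n) = ∑_{0<t≤N'} F(n₀ + r t)`. [folklore] -/
theorem sum_filter_modEq_Ioc_eq_sum_Ioc {α : Type*} [AddCommMonoid α] (F : ℕ → α) {r y : ℕ}
    (hr : 1 ≤ r) (hry : r ≤ y) (a H : ℕ) :
    ∑ n ∈ (Finset.Ioc y (y + H)).filter (fun n => n % r = a % r), F n =
      ∑ t ∈ Finset.Ioc 0 ((y + H - (y - (y - a % r) % r)) / r),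
        F ((y - (y - a % r) % r) + r * t) := by
  have har : a % r < r := Nat.mod_lt a (by omega)
  set s := (y - a % r) % r with hs
  have hsr : s < r := Nat.mod_lt _ (by omega)
  set n₀ := y - s with hn₀
  have hn₀y : n₀ ≤ y := Nat.sub_le y s
  have hyn₀ : y < n₀ + r := by omega
  -- `n₀ ≡ a (mod r)`
  have hn₀mod : n₀ % r = a % r := by
    have h1 : (y - a % r) % r = s := hs.symm
    have h2 := Nat.div_add_mod (y - a % r) r
    -- `y - a%r = r q + s`, so `n₀ = y - s = a % r + r q`
    have h3 : n₀ = a % r + r * ((y - a % r) / r) := by omega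
    rw [h3, Nat.add_mul_mod_self_left, Nat.mod_mod]
  symm
  refine Finset.sum_nbij' (fun t => n₀ + r * t) (fun n => (n - n₀) / r) ?_ ?_ ?_ ?_ ?_
  · intro t ht
    rw [Finset.mem_Ioc] at ht
    rw [Finset.mem_filter, Finset.mem_Ioc]
    obtain ⟨ht1, ht2⟩ := ht
    refine ⟨⟨?_, ?_⟩, ?_⟩
    · calc y < n₀ + r := hyn₀
        _ ≤ n₀ + r * t := by nlinarith
    · have h1 : r * t ≤ y + H - n₀ := (Nat.le_div_iff_mul_le (by omega)).mp ht2 |>.trans' (by rw [Nat.mul_comm])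
      omega
    · rw [Nat.add_mul_mod_self_left, hn₀mod]
  · intro n hn
    rw [Finset.mem_filter, Finset.mem_Ioc] at hn
    rw [Finset.mem_Ioc]
    obtain ⟨⟨hn1, hn2⟩, hnmod⟩ := hn
    -- `r ∣ n - n₀`
    have hdvd : r ∣ n - n₀ := by
      have h1 : n % r = n₀ % r := by rw [hnmod, hn₀mod]
      exact (Nat.modEq_iff_dvd' (by omega)).mp h1.symm
    obtain ⟨u, hu⟩ := hdvd
    have hu1 : 1 ≤ u := by
      by_contra h
      push Not at h
      have : u = 0 := by omega
      rw [this, mul_zero] at hu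
      omega
    rw [hu, Nat.mul_div_cancel_left _ (by omega)]
    refine ⟨hu1, ?_⟩
    rw [Nat.le_div_iff_mul_le (by omega), Nat.mul_comm]
    omega
  · intro t _
    show (n₀ + r * t - n₀) / r = t
    rw [Nat.add_sub_cancel_left, Nat.mul_div_cancel_left _ (by omega)]
  · intro n hn
    rw [Finset.mem_filter, Finset.mem_Ioc] at hn
    obtain ⟨⟨hn1, hn2⟩, hnmod⟩ := hn
    have hdvd : r ∣ n - n₀ := by
      have h1 : n % r = n₀ % r := by rw [hnmod, hn₀mod]
      exact (Nat.modEq_iff_dvd' (by omega)).mp h1.symm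
    show n₀ + r * ((n - n₀) / r) = n
    rw [Nat.mul_div_cancel' hdvd]
    omega
  · intro t _
    rfl

/-- The number of members of the progression, and the size of `N'`:
`#{y<n≤y+H : n≡a (r)} = N'` with `H/r - 1 < N' ≤ H/r + 1`… precisely `r N' ≤ H + r - 1` and
`H ≤ r N' + r - 1`. [folklore] -/
theorem card_filter_modEq_Ioc_eq {r y : ℕ} (hr : 1 ≤ r) (hry : r ≤ y) (a H : ℕ) :
    #((Finset.Ioc y (y + H)).filter (fun n => n % r = a % r)) =
      (y + H - (y - (y - a % r) % r)) / r ∧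
    H ≤ r * ((y + H - (y - (y - a % r) % r)) / r) + r ∧
    r * ((y + H - (y - (y - a % r) % r)) / r) ≤ H + r := by
  have hsr : (y - a % r) % r < r := Nat.mod_lt _ (by omega)
  refine ⟨?_, ?_, ?_⟩
  · have h := sum_filter_modEq_Ioc_eq_sum_Ioc (fun _ => (1 : ℕ)) hr hry a H
    simpa using h
  · have h1 := Nat.div_add_mod (y + H - (y - (y - a % r) % r)) r
    have h2 := Nat.mod_lt (y + H - (y - (y - a % r) % r)) (show 0 < r by omega)
    omega
  · have h1 := Nat.mul_div_le (y + H - (y - (y - a % r) % r)) r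
    omega

/-! ### The dichotomy for one starting point -/

/-- **Both cases of Proposition 5.4 for one progression** (Teräväinen 2024, §5.4). Data: the
Weyl-sum dichotomy of file XIII in degree `k` with constants `A, C` (hypothesis `hXIII`, the
conclusion of `weyl_sums_small_of_minorArc k`); absolute parameters `J ≥ 4`, `M`, `0 < ε_w ≤ 1`
with `ε' = J(12/(M+1) + 4(M+1)ε_w/π) ≤ 1` and `2/π + 8ε' + 23/J ≤ 1 - δ`, `0 < δ ≤ 1/3`; a number
of pieces `1 ≤ M₁ ≤ N` with `2π k² K₁ N/M₁ + M₁ ≤ δN/2` where `K₁ = C(8/ε_w²)^A`. Let `g` be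
`1`-bounded and `±1`-valued on `(0, N]`, `P ∈ ℝ[X]` of degree `≤ k`, `n₀, r ∈ ℝ`. If
`‖∑_{0<t≤N} g(t) e(-P(n₀ + r t))‖ > (1-δ)N`, then the phase is major arc with a denominator
`1 ≤ q ≤ M K₁` and some residue class `c (mod q)` on some piece `(jL, (j+1)L]` (`L = ⌊N/M₁⌋`,
`j < M₁`) carries a class sum `‖∑_{jL<t≤(j+1)L, t≡c (q)} g(t)‖ ≥ N/(2 M₁ q)`.
(Case 2 is impossible by file XV; in Case 1 file XVI and the pigeonhole principle apply.)
[cite: Teravainen2024, §5.4, proof of Proposition 5.4, Cases 1 and 2] -/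
theorem exists_large_classSum_of_large_correlation {k A : ℕ} {C : ℝ} (hC : 1 ≤ C)
    (hXIII : ∀ (δ : ℝ) (L : ℕ) (p : ℝ[X]) (J₀ : ℕ), 0 < δ → δ ≤ 1 → p.natDegree ≤ k → 1 ≤ L →
        (∀ q : ℕ, 1 ≤ q → (q : ℝ) ≤ J₀ * (C * (8 / δ ^ 2) ^ A) →
          ∃ i, 1 ≤ i ∧ i ≤ k ∧ C * (8 / δ ^ 2) ^ A / (L : ℝ) ^ i < distInt (q * p.coeff i)) →
        ∀ j : ℕ, 1 ≤ j → j ≤ J₀ →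
          ‖∑ n ∈ Finset.Ioc (0 : ℤ) L, VdC.e (j * p.eval (n : ℝ))‖ < δ * L)
    {J M : ℕ} (hJ : 4 ≤ J) {εw δ : ℝ} (hεw0 : 0 < εw) (hεw1 : εw ≤ 1) (hδ0 : 0 < δ)
    (hδ3 : δ ≤ 1 / 3)
    (hε' : (J : ℝ) * (12 / (M + 1) + 4 * (M + 1) * εw / Real.pi) ≤ 1)
    (hend : 2 / Real.pi + 8 * ((J : ℝ) * (12 / (M + 1) + 4 * (M + 1) * εw / Real.pi)) + 23 / J
      ≤ 1 - δ)
    {N M₁ : ℕ} (hM₁ : 1 ≤ M₁) (hM₁N : M₁ ≤ N)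
    (herr : 2 * Real.pi * (k : ℝ) ^ 2 * (C * (8 / εw ^ 2) ^ A) * N / M₁ + M₁ ≤ δ / 2 * N)
    (g : ℕ → ℤ) (hg1 : ∀ t, ‖((g t : ℤ) : ℂ)‖ ≤ 1)
    (hg : ∀ t ∈ Finset.Ioc 0 N, g t = 1 ∨ g t = -1)
    (P : ℝ[X]) (hP : P.natDegree ≤ k) (n₀ r : ℝ)
    (hbig : (1 - δ) * N <
      ‖∑ t ∈ Finset.Ioc 0 N, ((g t : ℤ) : ℂ) * VdC.e (-P.eval (n₀ + r * (t : ℝ)))‖) :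
    ∃ q : ℕ, 1 ≤ q ∧ (q : ℝ) ≤ M * (C * (8 / εw ^ 2) ^ A) ∧
      ∃ j ∈ Finset.range M₁, ∃ c ∈ Finset.range q,
        (N : ℝ) / (2 * M₁ * q) ≤
          ‖∑ t ∈ (Finset.Ioc (j * (N / M₁)) ((j + 1) * (N / M₁))).filter (fun t => t % q = c),
            ((g t : ℤ) : ℂ)‖ := by
  have hN : 1 ≤ N := hM₁.trans hM₁N
  have hNR : (0 : ℝ) < N := by exact_mod_cast hN
  have hM₁R : (0 : ℝ) < M₁ := by exact_mod_cast hM₁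
  set K₁ : ℝ := C * (8 / εw ^ 2) ^ A with hK₁
  have hK₁0 : 0 ≤ K₁ := by rw [hK₁]; positivity
  -- the re-parametrised phase `Q(t) = -P(n₀ + r t)`
  obtain ⟨P', hP'deg, -, hP'ev⟩ := exists_affineComp hP n₀ r
  set Q : ℝ[X] := -P' with hQ
  have hQdeg : Q.natDegree ≤ k := by rw [hQ, Polynomial.natDegree_neg]; exact hP'deg
  have hQev : ∀ t : ℝ, Q.eval t = -P.eval (n₀ + r * t) := by
    intro t; rw [hQ, Polynomial.eval_neg, hP'ev]
  have hbig' : (1 - δ) * N < ‖∑ t ∈ Finset.Ioc 0 N, ((g t : ℤ) : ℂ) * VdC.e (Q.eval (t : ℝ))‖ := by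
    simp only [hQev]; exact hbig
  -- the dichotomy
  by_cases hmin : ∀ q : ℕ, 1 ≤ q → (q : ℝ) ≤ M * (C * (8 / εw ^ 2) ^ A) →
      ∃ i, 1 ≤ i ∧ i ≤ k ∧ C * (8 / εw ^ 2) ^ A / (N : ℝ) ^ i < distInt (q * Q.coeff i)
  · -- Case 2 (minor arcs): impossible
    exfalso
    have hWeyl := hXIII εw N Q M hεw0 hεw1 hQdeg hN hmin
    have hW : ∀ j : ℕ, 1 ≤ j → j ≤ M →
        ‖∑ t ∈ Finset.Ioc 0 N, VdC.e (j * Q.eval (t : ℝ))‖ ≤ εw * N := by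
      intro j hj1 hjM
      have h := hWeyl j hj1 hjM
      rw [sum_Ioc_int_eq_sum_Ioc_nat (fun n : ℤ => VdC.e (j * Q.eval (n : ℝ))) N] at h
      simp only [Int.cast_natCast] at h
      exact h.le
    have hXV := minorArc_correlation_le hN hJ hεw0.le g hg (fun t => Q.eval (t : ℝ)) hε' hW
    have : (1 - δ) * N < (1 - δ) * N :=
      calc (1 - δ) * N < _ := hbig'
        _ ≤ _ := hXV
        _ ≤ (1 - δ) * N := mul_le_mul_of_nonneg_right hend hNR.le
    exact lt_irrefl _ this
  · -- Case 1 (major arcs)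
    push Not at hmin
    obtain ⟨q, hq1, hqle, hmaj⟩ := hmin
    have hmaj' : ∀ i, 1 ≤ i → i ≤ k → distInt (q * Q.coeff i) ≤ K₁ / (N : ℝ) ^ i := by
      intro i hi1 hik
      have := hmaj i hi1 hik
      rw [hK₁]; exact this
    refine ⟨q, hq1, hqle, ?_⟩
    have hqR : (1 : ℝ) ≤ q := by exact_mod_cast hq1
    have hXVI := majorArc_norm_sum_le hM₁ hM₁N hq1 (fun t => ((g t : ℤ) : ℂ)) hg1 Q hQdeg hK₁0 hmaj'
    -- the error terms are `≤ δN/2`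
    have herr' : 2 * Real.pi * (k : ℝ) ^ 2 * K₁ * N / (q * M₁) + M₁ ≤ δ / 2 * N := by
      refine le_trans (add_le_add ?_ le_rfl) herr
      rw [hK₁]
      rw [div_le_div_iff₀ (by positivity) hM₁R]
      have h0 : 0 ≤ 2 * Real.pi * (k : ℝ) ^ 2 * (C * (8 / εw ^ 2) ^ A) * N * M₁ := by positivity
      nlinarith
    -- pigeonhole
    by_contra hnone
    push Not at hnone
    have hsum : ∑ j ∈ Finset.range M₁, ∑ c ∈ Finset.range q,
        ‖∑ t ∈ (Finset.Ioc (j * (N / M₁)) ((j + 1) * (N / M₁))).filter (fun t => t % q = c),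
          ((g t : ℤ) : ℂ)‖ ≤ (N : ℝ) / 2 := by
      calc ∑ j ∈ Finset.range M₁, ∑ c ∈ Finset.range q,
            ‖∑ t ∈ (Finset.Ioc (j * (N / M₁)) ((j + 1) * (N / M₁))).filter (fun t => t % q = c),
              ((g t : ℤ) : ℂ)‖
          ≤ ∑ j ∈ Finset.range M₁, ∑ c ∈ Finset.range q, (N : ℝ) / (2 * M₁ * q) :=
            Finset.sum_le_sum fun j hj => Finset.sum_le_sum fun c hc => (hnone j hj c hc).le
        _ = (N : ℝ) / 2 := by
            rw [Finset.sum_const, Finset.card_range, nsmul_eq_mul, Finset.sum_const,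
              Finset.card_range, nsmul_eq_mul]
            field_simp
    have hchain : (1 - δ) * N < (N : ℝ) / 2 + δ / 2 * N :=
      calc (1 - δ) * N < _ := hbig'
        _ ≤ _ := hXVI
        _ ≤ (N : ℝ) / 2 + δ / 2 * N := by linarith [hsum, herr']
    nlinarith

/-! ### Tools for the counting step (Markov, shifts, transfer to progressions, growth, parameters) -/

/-- Markov's inequality on a finite set: `T · #{y ∈ S : T ≤ f(y)} ≤ ∑_{y∈S} f(y)` for `f ≥ 0`.
[folklore] -/
theorem card_filter_mul_le_sum {ι : Type*} (S : Finset ι) {f : ι → ℝ} (hf : ∀ y ∈ S, 0 ≤ f y)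
    (T : ℝ) :
    T * #(S.filter fun y => T ≤ f y) ≤ ∑ y ∈ S, f y := by
  classical
  calc T * #(S.filter fun y => T ≤ f y) = ∑ y ∈ S.filter (fun y => T ≤ f y), T := by
        rw [Finset.sum_const, nsmul_eq_mul, mul_comm]
    _ ≤ ∑ y ∈ S.filter (fun y => T ≤ f y), f y :=
        Finset.sum_le_sum fun y hy => (Finset.mem_filter.mp hy).2
    _ ≤ ∑ y ∈ S, f y :=
        Finset.sum_le_sum_of_subset_of_nonneg (Finset.filter_subset _ _) fun y hy _ => hf y hy

/-- Shifting a sum of nonnegative terms: `∑_{y<X} F(y + D) ≤ ∑_{y<X+D} F(y)`. [folklore] -/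
theorem sum_range_shift_le {F : ℕ → ℝ} (hF : ∀ y, 0 ≤ F y) (X D : ℕ) :
    ∑ y ∈ Finset.range X, F (y + D) ≤ ∑ y ∈ Finset.range (X + D), F y := by
  have h1 : ∑ y ∈ Finset.range X, F (y + D) = ∑ y ∈ Finset.Ico D (X + D), F y := by
    rw [Finset.sum_Ico_eq_sum_range, show X + D - D = X by omega]
    refine Finset.sum_congr rfl fun y _ => by rw [add_comm]
  rw [h1]
  exact Finset.sum_le_sum_of_subset_of_nonneg (fun y hy => by
    rw [Finset.mem_Ico] at hy; rw [Finset.mem_range]; exact hy.2) fun y _ _ => hF y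

/-- **Transfer of a class sum to a progression sum.** For `r ≥ 1`, `q ∈ ℕ` and any `F : ℕ → α`,
`∑_{jL<t≤(j+1)L, t≡c (q)} F(n₀ + r t) = ∑_{y_j<n≤y_j+rL, n≡n₀+rc (rq)} F(n)` with
`y_j = n₀ + r j L`. [folklore] -/
theorem sum_classSum_eq_sum_progression {α : Type*} [AddCommMonoid α] (F : ℕ → α) {r : ℕ}
    (hr : 1 ≤ r) (q n₀ j L c : ℕ) :
    ∑ t ∈ (Finset.Ioc (j * L) ((j + 1) * L)).filter (fun t => t % q = c % q), F (n₀ + r * t) =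
      ∑ n ∈ (Finset.Ioc (n₀ + r * (j * L)) (n₀ + r * (j * L) + r * L)).filter
          (fun n => n % (r * q) = (n₀ + r * c) % (r * q)), F n := by
  refine Finset.sum_nbij' (fun t => n₀ + r * t) (fun n => (n - n₀) / r) ?_ ?_ ?_ ?_ ?_
  · intro t ht
    rw [Finset.mem_filter, Finset.mem_Ioc] at ht
    rw [Finset.mem_filter, Finset.mem_Ioc]
    obtain ⟨⟨ht1, ht2⟩, htc⟩ := ht
    refine ⟨⟨by nlinarith, by nlinarith⟩, ?_⟩
    -- `t ≡ c (q)` gives `n₀ + r t ≡ n₀ + r c (rq)`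
    have h1 : t ≡ c [MOD q] := htc
    have h2 : r * t ≡ r * c [MOD r * q] := Nat.ModEq.mul_left' r h1
    exact Nat.ModEq.add_left n₀ h2
  · intro n hn
    rw [Finset.mem_filter, Finset.mem_Ioc] at hn
    rw [Finset.mem_filter, Finset.mem_Ioc]
    obtain ⟨⟨hn1, hn2⟩, hnc⟩ := hn
    -- `r ∣ n - n₀`
    have hmod : n ≡ n₀ + r * c [MOD r * q] := hnc
    have hmodr : n ≡ n₀ + r * c [MOD r] := Nat.ModEq.of_mul_right q hmod
    have hmodr' : n ≡ n₀ [MOD r] := by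
      have : n₀ + r * c ≡ n₀ [MOD r] := by
        show (n₀ + r * c) % r = n₀ % r
        rw [Nat.add_mul_mod_self_left]
      exact hmodr.trans this
    have hdvd : r ∣ n - n₀ := (Nat.modEq_iff_dvd' (by nlinarith)).mp hmodr'.symm
    obtain ⟨u, hu⟩ := hdvd
    have hn_eq : n = n₀ + r * u := by omega
    rw [hu, Nat.mul_div_cancel_left _ (by omega)]
    refine ⟨⟨?_, ?_⟩, ?_⟩
    · by_contra h; push Not at h
      have : r * u ≤ r * (j * L) := Nat.mul_le_mul_left r h
      omega
    · by_contra h; push Not at h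
      have h' := Nat.mul_le_mul_left r (Nat.succ_le_of_lt h)
      rw [Nat.mul_succ] at h'
      have e : r * ((j + 1) * L) = r * (j * L) + r * L := by ring
      omega
    · -- `n₀ + r u ≡ n₀ + r c (rq)` gives `u ≡ c (q)`
      rw [hn_eq] at hmod
      have h1 : r * u ≡ r * c [MOD r * q] := Nat.ModEq.add_left_cancel' n₀ hmod
      have h2 : u ≡ c [MOD q] := Nat.ModEq.mul_left_cancel' (by omega) h1
      exact h2
  · intro t _
    show (n₀ + r * t - n₀) / r = t
    rw [Nat.add_sub_cancel_left, Nat.mul_div_cancel_left _ (by omega)]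
  · intro n hn
    rw [Finset.mem_filter, Finset.mem_Ioc] at hn
    obtain ⟨⟨hn1, hn2⟩, hnc⟩ := hn
    have hmod : n ≡ n₀ + r * c [MOD r * q] := hnc
    have hmodr : n ≡ n₀ + r * c [MOD r] := Nat.ModEq.of_mul_right q hmod
    have hmodr' : n ≡ n₀ [MOD r] := by
      have : n₀ + r * c ≡ n₀ [MOD r] := by
        show (n₀ + r * c) % r = n₀ % r
        rw [Nat.add_mul_mod_self_left]
      exact hmodr.trans this
    have hdvd : r ∣ n - n₀ := (Nat.modEq_iff_dvd' (by nlinarith)).mp hmodr'.symm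
    show n₀ + r * ((n - n₀) / r) = n
    rw [Nat.mul_div_cancel' hdvd]
    have : n₀ ≤ n := by nlinarith
    omega
  · intro t _
    rfl

open Filter Asymptotics in
/-- Growth: for every `c` and `B` there is `H₀` with `c (log log H)^B ≤ log H` for all `H ≥ H₀`.
[folklore] -/
theorem exists_loglog_pow_le_log (c : ℝ) (B : ℕ) :
    ∃ H₀ : ℕ, ∀ H : ℕ, H₀ ≤ H → c * Real.log (Real.log H) ^ B ≤ Real.log H := by
  -- `(log x)^B = o(x)` as `x → ∞`, applied with `x = log H`
  have h1 : (fun x : ℝ => Real.log x ^ B) =o[atTop] id := Real.isLittleO_pow_log_id_atTop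
  have h2 : ∀ᶠ x : ℝ in atTop, |c| * |Real.log x ^ B| ≤ |x| := by
    rcases eq_or_ne c 0 with hc | hc
    · exact Eventually.of_forall fun x => by rw [hc, abs_zero, zero_mul]; exact abs_nonneg x
    · have hc' : 0 < |c| := abs_pos.mpr hc
      have := h1.def (inv_pos.mpr hc')
      filter_upwards [this] with x hx
      rw [Real.norm_eq_abs, Real.norm_eq_abs, id] at hx
      calc |c| * |Real.log x ^ B| ≤ |c| * (|c|⁻¹ * |x|) := mul_le_mul_of_nonneg_left hx hc'.le
        _ = |x| := by field_simp
  have h3 : Tendsto (fun H : ℕ => Real.log (H : ℝ)) atTop atTop :=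
    Real.tendsto_log_atTop.comp tendsto_natCast_atTop_atTop
  have h4 : ∀ᶠ H : ℕ in atTop, |c| * |Real.log (Real.log H) ^ B| ≤ |Real.log H| :=
    h3.eventually h2
  have h5 : ∀ᶠ H : ℕ in atTop, (1 : ℝ) ≤ H := by
    filter_upwards [eventually_ge_atTop 1] with H hH
    exact_mod_cast hH
  obtain ⟨H₀, hH₀⟩ := (h4.and h5).exists_forall_of_atTop
  refine ⟨H₀, fun H hH => ?_⟩
  obtain ⟨hA, hB⟩ := hH₀ H hH
  have hlog : 0 ≤ Real.log H := Real.log_nonneg hB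
  rw [abs_of_nonneg hlog] at hA
  calc c * Real.log (Real.log H) ^ B ≤ |c * Real.log (Real.log H) ^ B| := le_abs_self _
    _ = |c| * |Real.log (Real.log H) ^ B| := abs_mul _ _
    _ ≤ Real.log H := hA


/-- **Absolute endgame parameters** for Case 2 with `q = 2`: `J = 200`, `M = 199999`,
`ε_w = 10⁻¹⁰`, `δ = 1/30` satisfy `ε' = J(12/(M+1) + 4(M+1)ε_w/π) ≤ 1` and
`2/π + 8ε' + 23/J ≤ 1 - δ`. [folklore] -/
theorem endgame_params :
    ((200 : ℕ) : ℝ) * (12 / ((199999 : ℕ) + 1) + 4 * ((199999 : ℕ) + 1) * (1e-10 : ℝ) / Real.pi) ≤ 1 ∧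
    2 / Real.pi + 8 * (((200 : ℕ) : ℝ) * (12 / ((199999 : ℕ) + 1) +
      4 * ((199999 : ℕ) + 1) * (1e-10 : ℝ) / Real.pi)) + 23 / (200 : ℕ) ≤ 1 - 1 / 30 := by
  have hπ : 3.14 < Real.pi := Real.pi_gt_d2
  have h1 : 1 / Real.pi ≤ 1 / 3.14 := one_div_le_one_div_of_le (by norm_num) hπ.le
  have e2 : (2 : ℝ) / Real.pi = 2 * (1 / Real.pi) := by ring
  constructor
  · push_cast
    rw [show 4 * ((199999 : ℝ) + 1) * (1e-10 : ℝ) / Real.pi = 8e-5 * (1 / Real.pi) by ring]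
    nlinarith
  · push_cast
    rw [show 4 * ((199999 : ℝ) + 1) * (1e-10 : ℝ) / Real.pi = 8e-5 * (1 / Real.pi) by ring, e2]
    nlinarith


end Teravainen2024

end Literature.NumberTheory.Sieve
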